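import Literature.Analysis.Calculus.FlatCubeRootDescentReal
import HarnessLib

/-!
# Split smooth Newton theorem `S₂ ⊂ S₃`, formal part along the axis, I: the jet sequence

Topic `Analysis/Calculus`; cell `pub/hodgecm-mathlib`, N8-INNER brick (10)(A′) «SPLIT NEWTON `S₂ ⊂ S₃`» (sigsheet
`SIGSHEET-NewtonSplitThree.v1`, file F2, part I).  Count-neutral Literature THEOREMS (`--kind proof --supports
stmt-HodgeConjecture-24833`); no `def`, no instance, no notation, no `sorry`; frame of ★ `FlatCubeRootDescentReal`.

THE MATHEMATICS.  Coordinates `(u, t, z)` (variable `u` FIRST, then `t`, then the parameter `z ∈ P`); the cusp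
substitution is `v = (t³ − 3ut)/2 = t³/2 + w` with `w = −(3t/2)·u`.  For a smooth `H : ℝ × ℝ × P → E` we want smooth
`G₀, G₁, G₂ (u, v, z)` with `H (u, t, z) − Σ_{k<3} t^k • G_k (u, (t³−3ut)/2, z)` flat along `u = 0`.  Writing
`G_k (u, v, z) ∼ Σ_n uⁿ/n! • γ_{n,k} (v, z)` (Borel) and expanding `γ_{n,k} (t³/2 + w, z)` in `w`, flatness is the
TRIANGULAR system, for every order `m`,
  `∂ᵤᵐ H (0, t, z) = Σ_{(a,b) : a+b=m} Σ_k C(m,a) (−3t/2)^b t^k • ∂_w^b γ_{a,k} (t³/2 + w, z)|_{w=0}`        (EQ_m)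
whose unknown at stage `m` is the `(a,b) = (m,0)` term `Σ_k t^k • γ_{m,k} (t³/2, z)`: it is solved by the «mod 3»
decomposition (★ `exists_sum_pow_smul_comp_pow_three`: every smooth `r (t, z)` is `Σ_k t^k • ρ_k (t³, z)`), with
`γ_{m,k} (v, z) := ρ_k (2v, z)`.  This file builds the whole sequence `(γ_{n,k})` by recursion on `m`
(`exists_cuspJetSequence`); part II (`NewtonSplitThreeFormal`) Borel-sums it and proves the flatness.
HONEST LABEL: count-neutral Mathlib-side analysis; HC_CM is proved only modulo the printed citations (hLiu418 =
`stmt-HodgeConjecture-24832`, h413 = `stmt-HodgeConjecture-24833`) until rung 0 closes.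

## References
* [Whitney1943] H. Whitney, *Differentiable even functions*, Duke Math. J. 10 (1943) 159–160 («formal + flat»).
* [Glaeser1963Newton] G. Glaeser, *Fonctions composées différentiables*, Ann. of Math. 77 (1963) 193–209, Thm. II.
* [HormanderALPDO1] L. Hörmander, *The Analysis of Linear Partial Differential Operators I*, §1.1–1.2.
-/

noncomputable section

open Set Function Filter Topology Finset
open scoped ContDiff Nat

namespace Literature.Analysis.Calculus

universe u

variable {P : Type u} [NormedAddCommGroup P] [NormedSpace ℝ P] [FiniteDimensional ℝ P]
  {E : Type u} [NormedAddCommGroup E] [NormedSpace ℝ E] [CompleteSpace E]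

omit [FiniteDimensional ℝ P] [CompleteSpace E] in
/-- Shifted one-variable jets of a smooth `γ : ℝ × P → E` along the curve `v = t³/2` are smooth in `(t, z)`:
`(t, z) ↦ ∂_w^b γ (t³/2 + w, z)|_{w=0}`. [folklore] [cite: HormanderALPDO1, §1.1 Thm. 1.1.6] -/
theorem contDiff_iteratedDeriv_shift_cube {γ : ℝ × P → E} (hγ : ContDiff ℝ ∞ γ) (b : ℕ) :
    ContDiff ℝ ∞ (fun y : ℝ × P => iteratedDeriv b (fun w => γ (y.1 ^ 3 / 2 + w, y.2)) 0) := by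
  have hF : ContDiff ℝ ∞ (fun q : ℝ × (ℝ × P) => γ (q.2.1 ^ 3 / 2 + q.1, q.2.2)) :=
    hγ.comp ((((contDiff_fst.comp contDiff_snd).pow 3).div_const 2 |>.add contDiff_fst).prodMk
      (contDiff_snd.comp contDiff_snd))
  exact contDiff_iteratedDeriv_slice_fst_zero hF b

omit [FiniteDimensional ℝ P] [CompleteSpace E] in
/-- One term of the triangular system (EQ_m) is smooth in `(t, z)`. [folklore] [cite: HormanderALPDO1, §1.1 Thm. 1.1.6] -/
theorem contDiff_cuspJetTerm {γ : ℝ × P → E} (hγ : ContDiff ℝ ∞ γ) (m a b k : ℕ) :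
    ContDiff ℝ ∞ (fun y : ℝ × P => ((m.choose a : ℝ) * ((-(3 : ℝ) / 2 * y.1) ^ b * y.1 ^ k)) •
      iteratedDeriv b (fun w => γ (y.1 ^ 3 / 2 + w, y.2)) 0) :=
  (contDiff_const.mul (((contDiff_const.mul contDiff_fst).pow b).mul (contDiff_fst.pow k))).smul
    (contDiff_iteratedDeriv_shift_cube hγ b)

/-- **One stage of the recursion.** Given smooth `γs a k` (all `a`, `k`) and an order `m`, there are smooth new
entries `γnew k` such that, after updating the sequence at index `m`, the identity (EQ_m) holds with right-hand side
the prescribed smooth `hm (t, z)`: the `(m, 0)` term is `Σ_k t^k • γnew k (t³/2, z)`, solved by the «mod 3»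
decomposition of `hm − (the terms with a < m)`. [folklore] [cite: Whitney1943, Thm. 1] [cite: Glaeser1963Newton, Thm. II] -/
theorem exists_cuspJetStage (γs : ℕ → Fin 3 → ℝ × P → E) (hγs : ∀ a k, ContDiff ℝ ∞ (γs a k))
    (m : ℕ) (hm : ℝ × P → E) (hhm : ContDiff ℝ ∞ hm) :
    ∃ γnew : Fin 3 → ℝ × P → E, (∀ k, ContDiff ℝ ∞ (γnew k)) ∧ ∀ (t : ℝ) (z : P),
      ∑ p ∈ antidiagonal m, ∑ k : Fin 3,
        ((m.choose p.1 : ℝ) * ((-(3 : ℝ) / 2 * t) ^ p.2 * t ^ (k : ℕ))) •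
          iteratedDeriv p.2 (fun w => Function.update γs m γnew p.1 k (t ^ 3 / 2 + w, z)) 0 = hm (t, z) := by
  classical
  -- the known part (terms with `p ≠ (m, 0)`, all reading indices `< m`) and the residual `r`
  set r : ℝ × P → E := fun y => hm y - ∑ p ∈ (antidiagonal m).erase (m, 0), ∑ k : Fin 3,
      ((m.choose p.1 : ℝ) * ((-(3 : ℝ) / 2 * y.1) ^ p.2 * y.1 ^ (k : ℕ))) •
        iteratedDeriv p.2 (fun w => γs p.1 k (y.1 ^ 3 / 2 + w, y.2)) 0 with hr
  have hrs : ContDiff ℝ ∞ r := by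
    refine hhm.sub (ContDiff.sum fun p _ => ContDiff.sum fun k _ => ?_)
    exact contDiff_cuspJetTerm (hγs p.1 k) m p.1 p.2 k
  -- mod 3 decomposition of the residual
  obtain ⟨ρ, hρs, hρ⟩ := exists_sum_pow_smul_comp_pow_three r hrs
  refine ⟨fun k y => ρ k (2 * y.1, y.2), fun k => (hρs k).comp
    ((contDiff_const.mul contDiff_fst).prodMk contDiff_snd), fun t z => ?_⟩
  have hmem : ((m, 0) : ℕ × ℕ) ∈ antidiagonal m := by simp
  rw [← Finset.add_sum_erase _ _ hmem]
  -- the new term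
  have hnew : ∑ k : Fin 3, ((m.choose m : ℝ) * ((-(3 : ℝ) / 2 * t) ^ (0 : ℕ) * t ^ (k : ℕ))) •
      iteratedDeriv 0 (fun w => Function.update γs m (fun k y => ρ k (2 * y.1, y.2)) m k
        (t ^ 3 / 2 + w, z)) 0 = r (t, z) := by
    simp only [Nat.choose_self, Nat.cast_one, pow_zero, one_mul, iteratedDeriv_zero, add_zero,
      Function.update_self]
    rw [hρ t z, show (2 : ℝ) * (t ^ 3 / 2) = t ^ 3 by ring]
  -- the old terms are unchanged by the update (their first index is `< m`)
  have hold : ∀ p ∈ (antidiagonal m).erase (m, 0), ∀ k : Fin 3,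
      iteratedDeriv p.2 (fun w => Function.update γs m (fun k y => ρ k (2 * y.1, y.2)) p.1 k
        (t ^ 3 / 2 + w, z)) 0 = iteratedDeriv p.2 (fun w => γs p.1 k (t ^ 3 / 2 + w, z)) 0 := by
    rintro ⟨a, b⟩ hp k
    simp only [Finset.mem_erase, ne_eq, Prod.mk.injEq, HasAntidiagonal.mem_antidiagonal] at hp
    have hp1 : a ≠ m := fun h => hp.1 ⟨h, by omega⟩
    simp only [Function.update_of_ne hp1]
  rw [show ((m, 0) : ℕ × ℕ).1 = m from rfl, show ((m, 0) : ℕ × ℕ).2 = 0 from rfl, hnew,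
    Finset.sum_congr rfl fun p hp => Finset.sum_congr rfl fun k _ => by rw [hold p hp k]]
  simp only [hr]
  abel

/-- **The jet sequence of the formal part (triangular system solved to all orders).** For a smooth
`H : ℝ × ℝ × P → E` (variables `(u, t, z)`) there is a family of smooth `γ n k : ℝ × P → E` (`n : ℕ`, `k : Fin 3`,
variables `(v, z)`) such that for every order `m` and all `t, z`:
`∂ᵤᵐ H (0, t, z) = Σ_{(a,b) ∈ antidiagonal m} Σ_k C(m,a) (−3t/2)^b t^k • ∂_w^b γ_{a,k} (t³/2 + w, z)|_{w=0}` —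
the `u`-jets along `u = 0` of `Σ_k t^k • G_k (u, (t³−3ut)/2, z)` for any `G_k` with `u`-jets `γ_{·,k}` match those of `H`.
[folklore] [cite: Whitney1943, Thm. 1] [cite: Glaeser1963Newton, Thm. II] -/
theorem exists_cuspJetSequence (H : ℝ × ℝ × P → E) (hH : ContDiff ℝ ∞ H) :
    ∃ γ : ℕ → Fin 3 → ℝ × P → E, (∀ n k, ContDiff ℝ ∞ (γ n k)) ∧ ∀ (m : ℕ) (t : ℝ) (z : P),
      ∑ p ∈ antidiagonal m, ∑ k : Fin 3,
        ((m.choose p.1 : ℝ) * ((-(3 : ℝ) / 2 * t) ^ p.2 * t ^ (k : ℕ))) •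
          iteratedDeriv p.2 (fun w => γ p.1 k (t ^ 3 / 2 + w, z)) 0 =
        iteratedDeriv m (fun u => H (u, t, z)) 0 := by
  classical
  -- the `u`-jets of `H`, smooth in `(t, z)`
  set h : ℕ → ℝ × P → E := fun m y => iteratedDeriv m (fun u => H (u, y.1, y.2)) 0 with hh
  have hhs : ∀ m, ContDiff ℝ ∞ (h m) := fun m => contDiff_iteratedDeriv_slice_fst_zero (Y := ℝ × P) hH m
  -- the state space and the recursion
  let S := {γs : ℕ → Fin 3 → ℝ × P → E // ∀ a k, ContDiff ℝ ∞ (γs a k)}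
  let nxt : ℕ → S → S := fun m γs =>
    ⟨Function.update γs.1 m (Classical.choose (exists_cuspJetStage γs.1 γs.2 m (h m) (hhs m))), by
      intro a k
      by_cases ha : a = m
      · subst ha
        rw [Function.update_self]
        exact (Classical.choose_spec (exists_cuspJetStage γs.1 γs.2 a (h a) (hhs a))).1 k
      · rw [Function.update_of_ne ha]
        exact γs.2 a k⟩
  let zeroS : S := ⟨fun _ _ _ => 0, fun _ _ => contDiff_const⟩
  let st : ℕ → S := fun m => Nat.rec (nxt 0 zeroS) (fun m prev => nxt (m + 1) prev) m
  have hst0 : st 0 = nxt 0 zeroS := rfl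
  have hstS : ∀ m, st (m + 1) = nxt (m + 1) (st m) := fun m => rfl
  -- (EQ_m) holds for the state at stage `m`
  have hEQ : ∀ (m : ℕ) (t : ℝ) (z : P), ∑ p ∈ antidiagonal m, ∑ k : Fin 3,
      ((m.choose p.1 : ℝ) * ((-(3 : ℝ) / 2 * t) ^ p.2 * t ^ (k : ℕ))) •
        iteratedDeriv p.2 (fun w => (st m).1 p.1 k (t ^ 3 / 2 + w, z)) 0 = h m (t, z) := by
    intro m t z
    rcases m with _ | m
    · rw [hst0]
      exact (Classical.choose_spec (exists_cuspJetStage zeroS.1 zeroS.2 0 (h 0) (hhs 0))).2 t z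
    · rw [hstS]
      exact (Classical.choose_spec
        (exists_cuspJetStage (st m).1 (st m).2 (m + 1) (h (m + 1)) (hhs (m + 1)))).2 t z
  -- coherence: entries with index `≤ m` never change after stage `m`
  have hcoh : ∀ (m n : ℕ), m ≤ n → ∀ i ≤ m, (st n).1 i = (st m).1 i := by
    intro m n hmn
    induction n with
    | zero =>
      intro i hi
      have : m = 0 := Nat.le_zero.1 hmn
      subst this; rfl
    | succ n ih =>
      intro i hi
      rcases Nat.lt_or_eq_of_le hmn with hlt | heq
      · have hin : i ≠ n + 1 := by omega
        rw [hstS]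
        show Function.update (st n).1 (n + 1) _ i = _
        rw [Function.update_of_ne hin]
        exact ih (by omega) i hi
      · subst heq; rfl
  -- the diagonal sequence
  refine ⟨fun n => (st n).1 n, fun n k => (st n).2 n k, fun m t z => ?_⟩
  change _ = h m (t, z)
  rw [← hEQ m t z]
  refine Finset.sum_congr rfl fun p hp => Finset.sum_congr rfl fun k _ => ?_
  have hp1 : p.1 ≤ m := by rw [HasAntidiagonal.mem_antidiagonal] at hp; omega
  rw [hcoh p.1 m hp1 p.1 le_rfl]

end Literature.Analysis.Calculus

end
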